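import Literature.AnabelianGeometry.AbsoluteAnabelian.AbsTopIII.KummerCuspLaws
import HarnessLib

/-!
# [AbsTopIII] §1 model-interface laws: CONSISTENCY witness (the empty model)

Cell abc-iut, NV-lane style evidence for the interface owner's three successor structures
`NaturalKummerModel ⊆ TowerKummerModel ⊆ DescentKummerModel ⊆ CoherentKummerModel` (`KummerCurveLaws.lean`,
`KummerTowerLaws.lean`, `KummerDescentLaws.lean`, `KummerCuspLaws.lean`, abc-iut-L4-t1): the structures are JOINTLY SATISFIABLE —
witnessed, as for every model interface of the cell (typing policy θ, plan/L4/ASSIGNMENTS.md §2), by the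
DEGENERATE model with no curves at all (`Curve := PEmpty`; every law is vacuous; `degSign := 1`).  This is
CONSISTENCY-ONLY evidence (it says nothing about the intended étale-`π₁` model, whose existence is not
asserted anywhere in the tree); its purpose is to certify in the kernel that the ~135 fields carry no
hidden contradiction in their TYPES (e.g. an impossible dependent field).  The first layer
`NaturalKummerModel.nonempty_degenerate` is abc-iut-w5-d243's `KummerCurveLawsNonVacuity.lean` (not
restated here).  Theorems only, no definition.
HONEST FRAMING: nothing here bears on [IUTchIII] Cor. 3.12. [cite: MochizukiAbsTopIII2015, Thm 1.9 p.37]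
-/

noncomputable section

namespace Literature.AnabelianGeometry.AbsoluteAnabelian.AbsTopIII

universe u

/-- **The empty model**: `CoherentKummerModel` (hence `DescentKummerModel`, `TowerKummerModel`, `NaturalKummerModel`,
`IntrinsicKummerModel`, `DivisorCurveModel`, `CurveModel`) is inhabited by the model with no curves —
CONSISTENCY-ONLY witness (every per-curve law is vacuous). [cite: MochizukiAbsTopIII2015, Thm 1.9 p.37] -/
theorem nonempty_coherentKummerModel : Nonempty CoherentKummerModel.{u} :=
  ⟨{
      Curve := PEmpty.{u + 2}
      base := by intro U; exact nomatch U
      instField := by intro U; exact nomatch U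
      instCharZero := by intro U; exact nomatch U
      ext := by intro U; exact nomatch U
      galIso := by intro U; exact nomatch U
      cusps := by intro U; exact nomatch U
      IsProper := by intro U; exact nomatch U
      IsScheme := by intro U; exact nomatch U
      genus := by intro U; exact nomatch U
      FunctionField := by intro U; exact nomatch U
      instFunctionField := by intro U; exact nomatch U
      instAlgebra := by intro U; exact nomatch U
      Point := by intro U; exact nomatch U
      decomp := by intro U; exact nomatch U
      IsNFCurve := by intro U; exact nomatch U
      IsNFPoint := by intro U; exact nomatch U
      IsNFRational := by intro U; exact nomatch U
      IsNFConstant := by intro U; exact nomatch U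
      NFFunctionField := by intro U; exact nomatch U
      instNFFunctionField := by intro U; exact nomatch U
      IsStrictlyBelyiType := by intro U; exact nomatch U
      IsCofiniteOpen := by intro U; exact nomatch U
      res := by intro U; exact nomatch U
      IsRationalPt := by intro U; exact nomatch U
      ptSection := by intro U; exact nomatch U
      ptSection_range := by intro U; exact nomatch U
      ord := by intro U; exact nomatch U
      kummerMap := by intro U; exact nomatch U
      res_comp := by intro U; exact nomatch U
      fieldRes := by intro U; exact nomatch U
      baseRes := by intro U; exact nomatch U
      fieldRes_algebraMap := by intro U; exact nomatch U
      fieldRes_comp := by intro U; exact nomatch U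
      ptRes := by intro U; exact nomatch U
      ptRes_comp := by intro U; exact nomatch U
      ord_ptRes := by intro U; exact nomatch U
      decomp_ptRes := by intro U; exact nomatch U
      isRationalPt_ptRes := by intro U; exact nomatch U
      cuspPt := by intro U; exact nomatch U
      cuspPt_inj := by intro U; exact nomatch U
      cuspPt_ne_ptRes := by intro U; exact nomatch U
      exists_ptRes_or_cuspPt := by intro U; exact nomatch U
      cuspPt_isSome := by intro U; exact nomatch U
      decomp_cuspPt := by intro U; exact nomatch U
      decomp_cuspPt_none := by intro U; exact nomatch U
      isRational_cuspPt_iff := by intro U; exact nomatch U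
      isScheme_of_isCofiniteOpen := by intro U; exact nomatch U
      genus_eq_of_isCofiniteOpen := by intro U; exact nomatch U
      exists_open_removing := by intro U; exact nomatch U
      exists_open_between := by intro U; exact nomatch U
      isNFCurve_of_isCofiniteOpen := by intro U; exact nomatch U
      isNFPoint_ptRes := by intro U; exact nomatch U
      isNFRational_fieldRes := by intro U; exact nomatch U
      isNFConstant_baseRes := by intro U; exact nomatch U
      ord_const := by intro U; exact nomatch U
      isNFConstant_iff := by intro U; exact nomatch U
      kummer_natural := by intro U; exact nomatch U
      degSign := 1
      kummer_degree := by intro U; exact nomatch U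
      point_eq_of_decomp_conj := by intro U; exact nomatch U
      evalAt := by intro U; exact nomatch U
      evalAt_const := by intro U; exact nomatch U
      kummerRes_decomp_evalAt := by intro U; exact nomatch U
      kummerRes_decomp_const_eq_zero_iff := by intro U; exact nomatch U
      IsBaseChangeOf := by intro U; exact nomatch U
      bc := by intro U; exact nomatch U
      isBaseChange_bc := by intro U; exact nomatch U
      isOpenInjective_bc := by intro U; exact nomatch U
      isBaseChangeOf_refl := by intro U; exact nomatch U
      isBaseChangeOf_trans := by intro U; exact nomatch U
      bc_refl := by intro U; exact nomatch U
      bc_comp := by intro U; exact nomatch U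
      bcBase := by intro U; exact nomatch U
      finite_bcBase := by intro U; exact nomatch U
      bcField := by intro U; exact nomatch U
      bcField_algebraMap := by intro U; exact nomatch U
      bcBase_refl := by intro U; exact nomatch U
      bcField_refl := by intro U; exact nomatch U
      bcBase_comp := by intro U; exact nomatch U
      bcField_comp := by intro U; exact nomatch U
      bcEmb := by intro U; exact nomatch U
      bcEmb_comp_bcBase := by intro U; exact nomatch U
      bcEmb_comp_bcBase' := by intro U; exact nomatch U
      bcEmb_refl := by intro U; exact nomatch U
      exists_baseChange := by intro U; exact nomatch U
      isBaseChangeOf_of_range_subset := by intro U; exact nomatch U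
      bcPt := by intro U; exact nomatch U
      bcPt_surjective := by intro U; exact nomatch U
      bcPt_refl := by intro U; exact nomatch U
      bcPt_comp := by intro U; exact nomatch U
      ord_bcPt := by intro U; exact nomatch U
      decomp_bcPt := by intro U; exact nomatch U
      isRationalPt_of_bcPt := by intro U; exact nomatch U
      isNFPoint_bcPt := by intro U; exact nomatch U
      exists_cusp_bc := by intro U; exact nomatch U
      isRational_cusp_bc := by intro U; exact nomatch U
      isScheme_bc := by intro U; exact nomatch U
      isProper_bc := by intro U; exact nomatch U
      genus_bc := by intro U; exact nomatch U
      isNFCurve_bc := by intro U; exact nomatch U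
      isNFRational_bcField := by intro U; exact nomatch U
      isNFConstant_bcBase := by intro U; exact nomatch U
      isNFConstant_iff_mem_kbarNF := by intro U; exact nomatch U
      bc_res_comm := by intro U; exact nomatch U
      bcField_fieldRes := by intro U; exact nomatch U
      bcBase_baseRes := by intro U; exact nomatch U
      exists_bc_open := by intro U; exact nomatch U
      bcPt_ptRes := by intro U; exact nomatch U
      kummer_bc := by intro U; exact nomatch U
      geomField := by intro U; exact nomatch U
      instGeomField := by intro U; exact nomatch U
      toGeom := by intro U; exact nomatch U
      toGeom_comp_bcField := by intro U; exact nomatch U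
      geomBase := by intro U; exact nomatch U
      toGeom_algebraMap := by intro U; exact nomatch U
      geom_exhaust := by intro U; exact nomatch U
      nfToGeom := by intro U; exact nomatch U
      nfAlgebra := by intro U; exact nomatch U
      nfToGeom_algebraMap := by intro U; exact nomatch U
      isNFRational_iff_mem_range := by intro U; exact nomatch U
      nf_isAlgFunctionField := by intro U; exact nomatch U
      nf_genus := by intro U; exact nomatch U
      nfPlace := by intro U; exact nomatch U
      nfPlace_bcPt := by intro U; exact nomatch U
      exists_common_of_nfPlace_eq := by intro U; exact nomatch U
      nfPlace_surjective := by intro U; exact nomatch U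
      ord_nfPlace := by intro U; exact nomatch U
      mem_unitsWithValueOne_nfPlace_iff := by intro U; exact nomatch U
      cuspRes := by intro U; exact nomatch U
      decomp_cuspRes := by intro U; exact nomatch U
      exists_cuspRes_eq := by intro U; exact nomatch U
      cuspPt_comp_some := by intro U; exact nomatch U
      cuspPt_comp_none := by intro U; exact nomatch U
      decomp_inf_geom := by intro U; exact nomatch U
    }⟩

/-- Hence the intermediate successor structures are inhabited too (CONSISTENCY-ONLY).
[cite: MochizukiAbsTopIII2015, Thm 1.9 p.37] -/
theorem nonempty_descentKummerModel : Nonempty DescentKummerModel.{u} :=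
  ⟨(Classical.choice nonempty_coherentKummerModel).toDescentKummerModel⟩

/-- (CONSISTENCY-ONLY.) [cite: MochizukiAbsTopIII2015, Thm 1.9 p.37] -/
theorem nonempty_towerKummerModel : Nonempty TowerKummerModel.{u} :=
  ⟨(Classical.choice nonempty_coherentKummerModel).toTowerKummerModel⟩

end Literature.AnabelianGeometry.AbsoluteAnabelian.AbsTopIII
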